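import Mathlib.NumberTheory.LSeries.Convolution
import Mathlib.NumberTheory.LSeries.Dirichlet
import Mathlib.NumberTheory.Harmonic.ZetaAsymp
import Literature.NumberTheory.LFunctions.MoebiusRieszPerron
import Literature.NumberTheory.LFunctions.ZetaFractionalPartIntegral
import Literature.Analysis.Complex.VerticalLineIntegrals
import Literature.NumberTheory.Sieve.CircleMethod
import HarnessLib

/-!
# Zero detection for `ζ`: the mollified Riesz–Perron identity at a zero

Trunk T-ANT, topic `Literature/NumberTheory/LFunctions`. This file PROVES the zero-detecting
identity that drives Montgomery's zero-detection method for zero-density estimates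
(Ivić 1985, §11.2, (11.4)–(11.10); Montgomery 1971, Ch. 12; Huxley 1972, §23), in a variant with
the Riesz kernel `K(w) = 2/(w(w+1)(w+2))` and weights `(1 - n/Y)²₊` in place of Ivić's `Γ(w)` and
`e^{-n/Y}` (so that every integral is absolutely convergent by elementary bounds, and no Stirling
estimate is needed).

Let `M_X(s) = ∑_{d ≤ X} μ(d) d^{-s}` and `a_X(n) = ∑_{d ∣ n, d ≤ X} μ(d)`, so that
`ζ(s) M_X(s) = ∑ a_X(n) n^{-s}` (`Re s > 1`), `a_X(1) = 1`, `a_X(n) = 0` for `1 < n ≤ X`,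
`|a_X(n)| ≤ d(n)` (Ivić (11.6)). For a zero `ρ = β + iγ` of `ζ` with `1/2 < β` (`< 1`) and
integers `X, Y ≥ 1`:

  `∑_{n ≤ Y} a_X(n) (1 - n/Y)² n^{-ρ}`
    `= Y^{1-ρ} K(1-ρ) M_X(1) + (1/2π) ∫_ℝ Y^{-η+iy} K(-η+iy) ζ(½ + i(γ+y)) M_X(½ + i(γ+y)) dy`,
  `η = β - 1/2`  (`Literature.NumberTheory.LFunctions.ZeroDetect.zeroDetection_identity`),

obtained from the Riesz–Perron formula on `Re w = 2` (`rieszSum_eq_integral_LSeries`, Mellin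
inversion for `(1-u)²₊`, as in `MoebiusRieszPerron.lean`) by moving the line to `Re w = -η`: the pole
of `K` at `w = 0` is cancelled by `ζ(ρ) = 0`, and the pole of `ζ(ρ + w)` at `w = 1 - ρ` leaves the
residue `Y^{1-ρ} K(1-ρ) M_X(1)` (Ivić (11.5)–(11.7)). The shift is Cauchy's theorem between two
vertical lines (`Literature.NumberTheory.LFunctions.MertensBoundRH.integral_vertical_eq_of_tendsto`) for the pole-free parts,
written with `dslope`, plus the explicit line integrals of `K` and of `2/((w+1)(w+2)(w-w₁))`
(`Literature.Analysis.Complex.VLI.integral_inv_sub_inv`).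

Consequence (`zeroDetection_norm_ineq`, the Class I / Class II dichotomy of Ivić (11.9)–(11.10)):
`(1 - 1/Y)² ≤ |∑_{X < n ≤ Y} a_X(n)(1-n/Y)² n^{-ρ}| + Y^{1-β} |K(1-ρ)| (1 + log X)`
`+ (Y^{-η}/2π) ∫ |K(-η+iy)| |ζ(½+i(γ+y))| |M_X(½+i(γ+y))| dy` (using `|M_X(1)| ≤ 1 + log X`).

## Main results

* `Literature.NumberTheory.LFunctions.ZeroDetect.mollifier`, `moebiusTruncSeq` (`Literature.NumberTheory.Sieve.moebiusTrunc` as a complex sequence),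
  `mollCoeff` (`M_X`, `a_X`), `mollCoeff_one`, `mollCoeff_eq_zero`,
  `norm_mollCoeff_le` (`|a_X(n)| ≤ d(n)`), `LSeries_mollCoeff` (`∑ a_X(n) n^{-s} = ζ(s) M_X(s)`).
* `Literature.NumberTheory.LFunctions.ZeroDetect.rieszSum_eq_integral` : Perron's formula for the Riesz means on `Re w = c`.
* `Literature.NumberTheory.LFunctions.ZeroDetect.zeroDetection_identity`, `Literature.NumberTheory.LFunctions.ZeroDetect.integrable_zeroDetection_integrand`,
  `Literature.NumberTheory.LFunctions.ZeroDetect.zeroDetection_norm_ineq`.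

## References

* A. Ivić, *The Riemann zeta-function*, Wiley 1985, §11.2, (11.4)–(11.10).
* H. L. Montgomery, *Topics in multiplicative number theory*, LNM 227 (1971), Ch. 12.
* E. C. Titchmarsh, *The Theory of the Riemann Zeta-Function*, 2nd ed. (1986), §9.16 (the
  mollifier `M_X` and the coefficients `a_X(n)`), §3.12 (Perron's formula).
-/

noncomputable section


open Complex Filter Topology Set MeasureTheory Finset
open scoped Real

namespace Literature.NumberTheory.LFunctions

namespace ZeroDetect

/-! ### The Riesz kernel, the mollifier and the coefficients `a_X(n)` -/

/-- The Riesz kernel `K(z) = 1/z - 2/(z+1) + 1/(z+2) = 2/(z(z+1)(z+2))`, the Mellin transform of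
`(1-u)²₊`. [folklore] -/
def rieszK (z : ℂ) : ℂ := 1 / z - 2 / (z + 1) + 1 / (z + 2)

/-- The mollifier `M_X(s) = ∑_{d ≤ X} μ(d) d^{-s}` (Titchmarsh §9.16; Ivić §11.2). [folklore] -/
def mollifier (X : ℕ) (s : ℂ) : ℂ :=
  ∑ d ∈ Finset.Icc 1 X, ((ArithmeticFunction.moebius d : ℤ) : ℂ) * (d : ℂ) ^ (-s)

/-- The truncated Möbius function `μ_X` of the tree (`Literature.moebiusTrunc X : ArithmeticFunction ℤ`,
`Literature/NumberTheory/Sieve/CircleMethod.lean`) read as a complex sequence, for use with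
`LSeries`: `μ_X(d) = μ(d)` for `d ≤ X`, `0` for `d > X`. [folklore] -/
abbrev moebiusTruncSeq (X : ℕ) : ℕ → ℂ := fun d ↦ ((Literature.NumberTheory.Sieve.moebiusTrunc X d : ℤ) : ℂ)

/-- Unfolding: `μ_X(d) = μ(d)` if `d ≤ X`, else `0` (from `Literature.NumberTheory.Sieve.moebiusTrunc_apply`). [folklore] -/
theorem moebiusTruncSeq_apply (X d : ℕ) :
    moebiusTruncSeq X d = if d ≤ X then ((ArithmeticFunction.moebius d : ℤ) : ℂ) else 0 := by
  simp only [moebiusTruncSeq, Literature.NumberTheory.Sieve.moebiusTrunc_apply]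
  split_ifs <;> simp

/-- The coefficients `a_X = 1 ⋆ μ_X` of `ζ(s) M_X(s)`, i.e. `a_X(n) = ∑_{d ∣ n, d ≤ X} μ(d)`
(Ivić (11.6); Titchmarsh §9.16). [folklore] -/
def mollCoeff (X : ℕ) : ℕ → ℂ := LSeries.convolution (1 : ℕ → ℂ) (moebiusTruncSeq X)

/-- `|μ_X(d)| ≤ 1`. [folklore] -/
lemma norm_moebiusTruncSeq_le (X d : ℕ) : ‖moebiusTruncSeq X d‖ ≤ 1 := by
  rw [moebiusTruncSeq_apply]
  split_ifs
  · rw [Complex.norm_intCast]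
    exact_mod_cast ArithmeticFunction.abs_moebius_le_one
  · simp

/-- `a_X(n) = ∑_{d ∣ n, d ≤ X} μ(d)`. [folklore] -/
theorem mollCoeff_eq_sum (X : ℕ) (n : ℕ) :
    mollCoeff X n = ∑ d ∈ n.divisors.filter (· ≤ X), ((ArithmeticFunction.moebius d : ℤ) : ℂ) := by
  rw [mollCoeff, LSeries.convolution_def]
  simp only [Pi.one_apply, one_mul]
  rw [Nat.sum_divisorsAntidiagonal' (fun _ d ↦ moebiusTruncSeq X d), Finset.sum_filter]
  refine Finset.sum_congr rfl fun d _ ↦ ?_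
  rw [moebiusTruncSeq_apply]

/-- `|a_X(n)| ≤ d(n)`. [cite: Ivic1985, (11.6)] -/
theorem norm_mollCoeff_le (X n : ℕ) : ‖mollCoeff X n‖ ≤ (n.divisors.card : ℝ) := by
  rw [mollCoeff_eq_sum]
  calc ‖∑ d ∈ n.divisors.filter (· ≤ X), ((ArithmeticFunction.moebius d : ℤ) : ℂ)‖
      ≤ ∑ d ∈ n.divisors.filter (· ≤ X), ‖((ArithmeticFunction.moebius d : ℤ) : ℂ)‖ :=
        norm_sum_le _ _
    _ ≤ ∑ d ∈ n.divisors.filter (· ≤ X), (1 : ℝ) := Finset.sum_le_sum fun d _ ↦ by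
        rw [Complex.norm_intCast]; exact_mod_cast ArithmeticFunction.abs_moebius_le_one
    _ ≤ ∑ d ∈ n.divisors, (1 : ℝ) :=
        Finset.sum_le_sum_of_subset_of_nonneg (Finset.filter_subset _ _) fun _ _ _ ↦ zero_le_one
    _ = (n.divisors.card : ℝ) := by simp

/-- The crude bound `|a_X(n)| ≤ n`. [folklore] -/
theorem norm_mollCoeff_le_self (X n : ℕ) : ‖mollCoeff X n‖ ≤ (n : ℝ) :=
  (norm_mollCoeff_le X n).trans (by exact_mod_cast Nat.card_divisors_le_self n)

/-- `a_X(1) = 1` (`X ≥ 1`). [cite: Ivic1985, (11.5)–(11.6)] -/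
theorem mollCoeff_one {X : ℕ} (hX : 1 ≤ X) : mollCoeff X 1 = 1 := by
  rw [mollCoeff_eq_sum, Nat.divisors_one, Finset.filter_singleton, if_pos hX,
    Finset.sum_singleton]
  simp

/-- `a_X(n) = 0` for `1 < n ≤ X` (all divisors are `≤ X` and `∑_{d ∣ n} μ(d) = 0`; the same
vanishing for the `ℝ`-valued Dirichlet product is `Literature.NumberTheory.Sieve.HeathBrown.moebiusTrunc_mul_zeta_apply` in
`Literature/NumberTheory/Sieve/HeathBrownIdentity.lean`). [cite: Ivic1985, (11.5)–(11.6)] -/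
theorem mollCoeff_eq_zero {X n : ℕ} (h1 : 1 < n) (hn : n ≤ X) : mollCoeff X n = 0 := by
  rw [mollCoeff_eq_sum]
  have hfilter : n.divisors.filter (· ≤ X) = n.divisors := by
    refine Finset.filter_true_of_mem fun d hd ↦ ?_
    exact (Nat.divisor_le hd).trans hn
  rw [hfilter]
  have h : ∑ d ∈ n.divisors, (ArithmeticFunction.moebius d : ℤ) = 0 := by
    rw [← ArithmeticFunction.coe_mul_zeta_apply, ArithmeticFunction.moebius_mul_coe_zeta,
      ArithmeticFunction.one_apply_ne (by omega)]
  have : (∑ d ∈ n.divisors, ((ArithmeticFunction.moebius d : ℤ) : ℂ)) =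
      ((∑ d ∈ n.divisors, (ArithmeticFunction.moebius d : ℤ) : ℤ) : ℂ) := by push_cast; rfl
  rw [this, h]
  simp

/-- `L(μ_X, s) = M_X(s)` (a finite Dirichlet series). [folklore] -/
theorem LSeries_moebiusTruncSeq (X : ℕ) (s : ℂ) : LSeries (moebiusTruncSeq X) s = mollifier X s := by
  rw [LSeries, mollifier, tsum_eq_sum (s := Finset.range (X + 1))]
  · rw [Finset.range_eq_Ico, ← Finset.insert_Ico_add_one_left_eq_Ico (by omega : 0 < X + 1),
      Finset.sum_insert (by simp), LSeries.term_zero, zero_add]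
    simp only [zero_add]
    rw [show Finset.Ico 1 (X + 1) = Finset.Icc 1 X from rfl]
    refine Finset.sum_congr rfl fun d hd ↦ ?_
    simp only [Finset.mem_Icc] at hd
    rw [LSeries.term_of_ne_zero (by omega), moebiusTruncSeq_apply, if_pos hd.2, cpow_neg, div_eq_mul_inv]
  · intro d hd
    simp only [Finset.mem_range, not_lt] at hd
    rcases Nat.eq_zero_or_pos d with rfl | hd0
    · exact LSeries.term_zero _ _
    · rw [LSeries.term_of_ne_zero hd0.ne', moebiusTruncSeq_apply, if_neg (by omega), zero_div]

/-- `ζ(s) M_X(s) = L(a_X, s)` for `Re s > 1`. [cite: Ivic1985, (11.5)–(11.6)] -/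
theorem LSeries_mollCoeff {X : ℕ} {s : ℂ} (hs : 1 < s.re) :
    LSeries (mollCoeff X) s = riemannZeta s * mollifier X s := by
  rw [mollCoeff, LSeries_convolution' (LSeriesSummable_one_iff.2 hs)
    (LSeriesSummable_of_bounded_of_one_lt_re (fun d _ ↦ norm_moebiusTruncSeq_le X d) hs),
    LSeries_moebiusTruncSeq]
  congr 1
  exact LSeries_one_eq_riemannZeta hs

/-- `|M_X(s)| ≤ X` for `Re s ≥ 0` (crude). [folklore] -/
theorem norm_mollifier_le {X : ℕ} {s : ℂ} (hs : 0 ≤ s.re) : ‖mollifier X s‖ ≤ X := by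
  unfold mollifier
  calc ‖∑ d ∈ Finset.Icc 1 X, ((ArithmeticFunction.moebius d : ℤ) : ℂ) * (d : ℂ) ^ (-s)‖
      ≤ ∑ d ∈ Finset.Icc 1 X, ‖((ArithmeticFunction.moebius d : ℤ) : ℂ) * (d : ℂ) ^ (-s)‖ :=
        norm_sum_le _ _
    _ ≤ ∑ d ∈ Finset.Icc 1 X, (1 : ℝ) := Finset.sum_le_sum fun d hd ↦ by
        simp only [Finset.mem_Icc] at hd
        have hd0 : (0 : ℝ) < d := by exact_mod_cast hd.1
        rw [norm_mul, show ((d : ℂ)) = ((d : ℝ) : ℂ) by norm_cast,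
          Complex.norm_cpow_eq_rpow_re_of_pos hd0, neg_re]
        have h1 : ‖((ArithmeticFunction.moebius d : ℤ) : ℂ)‖ ≤ 1 := by
          rw [Complex.norm_intCast]; exact_mod_cast ArithmeticFunction.abs_moebius_le_one
        have h2 : (d : ℝ) ^ (-s.re) ≤ 1 :=
          Real.rpow_le_one_of_one_le_of_nonpos (by exact_mod_cast hd.1) (by linarith)
        exact mul_le_one₀ h1 (Real.rpow_nonneg hd0.le _) h2
    _ = X := by simp

/-- `|M_X(1)| ≤ ∑_{d ≤ X} 1/d ≤ 1 + log X`. [folklore] -/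
theorem norm_mollifier_one_le (X : ℕ) : ‖mollifier X 1‖ ≤ 1 + Real.log X := by
  unfold mollifier
  calc ‖∑ d ∈ Finset.Icc 1 X, ((ArithmeticFunction.moebius d : ℤ) : ℂ) * (d : ℂ) ^ (-(1 : ℂ))‖
      ≤ ∑ d ∈ Finset.Icc 1 X, ‖((ArithmeticFunction.moebius d : ℤ) : ℂ) * (d : ℂ) ^ (-(1 : ℂ))‖ :=
        norm_sum_le _ _
    _ ≤ ∑ d ∈ Finset.Icc 1 X, (1 : ℝ) / d := Finset.sum_le_sum fun d hd ↦ by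
        simp only [Finset.mem_Icc] at hd
        have hd0 : (0 : ℝ) < d := by exact_mod_cast hd.1
        rw [norm_mul, cpow_neg_one, norm_inv, Complex.norm_natCast]
        have h1 : ‖((ArithmeticFunction.moebius d : ℤ) : ℂ)‖ ≤ 1 := by
          rw [Complex.norm_intCast]; exact_mod_cast ArithmeticFunction.abs_moebius_le_one
        calc ‖((ArithmeticFunction.moebius d : ℤ) : ℂ)‖ * (d : ℝ)⁻¹ ≤ 1 * (d : ℝ)⁻¹ := by gcongr
          _ = 1 / d := by ring
    _ ≤ 1 + Real.log X := by
        have h := harmonic_le_one_add_log X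
        have e : ∑ d ∈ Finset.Icc 1 X, (1 : ℝ) / d = (harmonic X : ℝ) := by
          rw [harmonic_eq_sum_Icc]
          push_cast
          refine Finset.sum_congr rfl fun d _ ↦ by simp
        rw [e]
        exact h

/-! ### Perron's formula for the Riesz means of `ζ(s) M_X(s) = ∑ a_X(n) n^{-s}` -/

open RieszPerron in
/-- **Perron's formula for the Riesz means of `a_X(n) n^{-s}`** (absolutely convergent form; Ivić
(11.4)–(11.5) with the Riesz kernel): for `c > 0`, `Y ≥ 1` and `Re s + c > 2`,
`∑_{n ≤ Y} a_X(n)(1 - n/Y)² n^{-s} = (1/2π) ∫_ℝ Y^{c+iy} K(c+iy) ζ(s+c+iy) M_X(s+c+iy) dy`.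
(Insert `(1-n/Y)₊² = (1/2π)∫ (n/Y)^{-z}K(z)dy` and sum the absolutely convergent Dirichlet series
`∑ a_X(n) n^{-s-z} = ζ M_X (s+z)` under the integral; `|a_X(n)| ≤ n` is why `Re s + c > 2` is
assumed.) [cite: Ivic1985, (11.4)–(11.5)] -/
theorem rieszSum_eq_integral {c : ℝ} (hc : 0 < c) {s : ℂ} (hs : 2 < s.re + c) (X : ℕ) {Y : ℕ}
    (hY : 0 < Y) :
    ∑ n ∈ Finset.range Y, mollCoeff X (n + 1) *
        ((((1 : ℝ) - ((n : ℝ) + 1) / Y) ^ 2 : ℝ) : ℂ) * ((n : ℂ) + 1) ^ (-s) =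
      ((1 / (2 * π) : ℝ) : ℂ) * ∫ y : ℝ, (Y : ℂ) ^ ((c : ℂ) + y * I) * rieszK (c + y * I) *
        (riemannZeta (s + c + y * I) * mollifier X (s + c + y * I)) := by
  have hY' : (0 : ℝ) < Y := by exact_mod_cast hY
  -- the summands as a function on ℕ
  set T : ℕ → ℂ := fun a ↦ mollCoeff X a * (a : ℂ) ^ (-s) *
    ((((max (1 - ((a : ℝ) / Y)) 0) ^ 2 : ℝ)) : ℂ) with hT
  -- Step A: the finite sum is `∑' a, T a`
  have hT0 : T 0 = 0 := by simp [hT, mollCoeff]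
  have hTvan : ∀ a ∉ Finset.range (Y + 1), T a = 0 := by
    intro a ha
    rw [Finset.mem_range, not_lt] at ha
    have : (1 : ℝ) ≤ (a : ℝ) / Y := by
      rw [le_div_iff₀ hY', one_mul]; exact_mod_cast (by omega : Y ≤ a)
    simp [hT, max_eq_right (by linarith : (1 : ℝ) - a / Y ≤ 0)]
  have hsumT : ∑ n ∈ Finset.range Y, mollCoeff X (n + 1) *
      ((((1 : ℝ) - ((n : ℝ) + 1) / Y) ^ 2 : ℝ) : ℂ) * ((n : ℂ) + 1) ^ (-s) = ∑' a, T a := by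
    rw [tsum_eq_sum hTvan, Finset.sum_range_succ', hT0, add_zero]
    refine Finset.sum_congr rfl fun a ha ↦ ?_
    rw [Finset.mem_range] at ha
    have hle : ((a : ℝ) + 1) / Y ≤ 1 := by
      rw [div_le_one hY']; exact_mod_cast (by omega : a + 1 ≤ Y)
    simp only [hT]
    rw [max_eq_left (by push_cast; linarith)]
    push_cast
    ring
  rw [hsumT]
  -- Step B: each `T a` is an integral
  set F : ℕ → ℝ → ℂ := fun a y ↦ mollCoeff X a * (a : ℂ) ^ (-s) *
    (((1 / (2 * π) : ℝ) : ℂ) * ((((a : ℝ) / Y : ℝ)) : ℂ) ^ (-((c : ℂ) + y * I)) * rieszK (c + y * I))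
    with hF
  have hK : ∀ y : ℝ, rieszK (c + y * I) =
      ((1 : ℂ) / (c + y * I) - 2 / ((c + y * I) + 1) + 1 / ((c + y * I) + 2)) := fun y ↦ rfl
  have hTF : ∀ a, T a = ∫ y, F a y := by
    intro a
    rcases Nat.eq_zero_or_pos a with rfl | ha
    · simp [hT, hF, mollCoeff]
    · have hx : (0 : ℝ) < (a : ℝ) / Y := by positivity
      simp only [hT, hF, hK]
      rw [kfun_eq_integral hc hx, ← integral_const_mul, ← integral_const_mul]
      refine integral_congr_ae (Eventually.of_forall fun y ↦ ?_)
      simp only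
      ring
  -- Step C: interchange sum and integral
  have hKint := integrable_Kfun_line (σ := c) (m := c) hc (by rw [abs_of_pos hc])
    (by rw [abs_of_pos (by linarith)]; linarith) (by rw [abs_of_pos (by linarith)]; linarith)
  have hc0 : (c : ℝ) ≠ 0 := hc.ne'
  have hc1 : c + 1 ≠ 0 := by linarith
  have hc2 : c + 2 ≠ 0 := by linarith
  have hKcont : Continuous fun y : ℝ ↦ rieszK (c + y * I) := by
    simp only [hK]; exact continuous_Kfun_line hc0 hc1 hc2
  have hFmeas : ∀ a, AEStronglyMeasurable (F a) volume := by
    intro a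
    refine Continuous.aestronglyMeasurable ?_
    simp only [hF]
    refine continuous_const.mul ((continuous_const.mul ?_).mul hKcont)
    rcases Nat.eq_zero_or_pos a with rfl | ha
    · have : ∀ y : ℝ, ((((0 : ℕ) : ℝ) / Y : ℝ) : ℂ) ^ (-((c : ℂ) + y * I)) = 0 := by
        intro y
        rw [Nat.cast_zero, zero_div, ofReal_zero, zero_cpow]
        intro h
        have := congrArg re h
        simp at this
        exact hc0 this
      simp only [this]
      exact continuous_const
    · have hx : (0 : ℝ) < (a : ℝ) / Y := by positivity
      refine Continuous.const_cpow (by fun_prop) (Or.inl ?_)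
      exact_mod_cast hx.ne'
  -- norm bound for the summands
  have hFnorm : ∀ a (y : ℝ), ‖F a y‖ ≤
      (1 / (2 * π) * (Y : ℝ) ^ c) * ((a : ℝ) ^ (-(s.re + c - 1))) * ‖rieszK (c + y * I)‖ := by
    intro a y
    rcases Nat.eq_zero_or_pos a with rfl | ha
    · simp [hF, mollCoeff]
      positivity
    have ha' : (0 : ℝ) < a := by exact_mod_cast ha
    have hx : (0 : ℝ) < (a : ℝ) / Y := by positivity
    simp only [hF, norm_mul]
    rw [show ((a : ℂ)) = ((a : ℝ) : ℂ) by norm_cast, Complex.norm_cpow_eq_rpow_re_of_pos ha',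
      Complex.norm_cpow_eq_rpow_re_of_pos hx, Complex.norm_real, Real.norm_eq_abs,
      abs_of_pos (by positivity : (0 : ℝ) < 1 / (2 * π))]
    simp only [neg_re, add_re, ofReal_re, mul_re, I_re, mul_zero, ofReal_im, I_im, mul_one,
      sub_self, add_zero]
    have hμ : ‖mollCoeff X a‖ ≤ (a : ℝ) := norm_mollCoeff_le_self X a
    have e1 : ((a : ℝ) / Y) ^ (-c) = (a : ℝ) ^ (-c) * (Y : ℝ) ^ c := by
      rw [Real.div_rpow ha'.le hY'.le, Real.rpow_neg hY'.le, div_inv_eq_mul]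
    have e2 : (a : ℝ) * ((a : ℝ) ^ (-s.re) * (a : ℝ) ^ (-c)) = (a : ℝ) ^ (-(s.re + c - 1)) := by
      rw [← Real.rpow_add ha', show (a : ℝ) = (a : ℝ) ^ (1 : ℝ) from (Real.rpow_one _).symm,
        ← Real.rpow_mul ha'.le, ← Real.rpow_mul ha'.le, ← Real.rpow_add ha']
      ring_nf
    have hK0 : 0 ≤ ‖rieszK (c + y * I)‖ := norm_nonneg _
    have hpos1 : 0 ≤ (a : ℝ) ^ (-s.re) := Real.rpow_nonneg ha'.le _
    calc ‖mollCoeff X a‖ * (a : ℝ) ^ (-s.re) *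
          (1 / (2 * π) * ((a : ℝ) / Y) ^ (-c) * ‖rieszK (c + y * I)‖)
        ≤ (a : ℝ) * (a : ℝ) ^ (-s.re) * (1 / (2 * π) * ((a : ℝ) / Y) ^ (-c) * ‖rieszK (c + y * I)‖) := by
          gcongr
      _ = (1 / (2 * π) * (Y : ℝ) ^ c) * ((a : ℝ) * ((a : ℝ) ^ (-s.re) * (a : ℝ) ^ (-c))) *
          ‖rieszK (c + y * I)‖ := by rw [e1]; ring
      _ = (1 / (2 * π) * (Y : ℝ) ^ c) * ((a : ℝ) ^ (-(s.re + c - 1))) * ‖rieszK (c + y * I)‖ := by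
          rw [e2]
  have hsum : Summable fun a : ℕ ↦ (a : ℝ) ^ (-(s.re + c - 1)) :=
    Real.summable_nat_rpow.mpr (by linarith)
  have hFint : ∑' a, ∫⁻ y, ‖F a y‖ₑ ≠ ⊤ := by
    have hle : ∀ a, ∫⁻ y, ‖F a y‖ₑ ≤
        ENNReal.ofReal ((1 / (2 * π) * (Y : ℝ) ^ c) * (a : ℝ) ^ (-(s.re + c - 1))) *
          ∫⁻ y : ℝ, ‖rieszK (c + y * I)‖ₑ := by
      intro a
      rw [← lintegral_const_mul' _ _ ENNReal.ofReal_ne_top]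
      refine lintegral_mono fun y ↦ ?_
      rw [← enorm_norm (rieszK (c + y * I)), ← enorm_norm (F a y),
        Real.enorm_eq_ofReal (norm_nonneg _), Real.enorm_eq_ofReal (norm_nonneg _),
        ← ENNReal.ofReal_mul (by positivity)]
      exact ENNReal.ofReal_le_ofReal (hFnorm a y)
    refine ne_top_of_le_ne_top ?_ (ENNReal.tsum_le_tsum hle)
    rw [ENNReal.tsum_mul_right]
    refine ENNReal.mul_ne_top ?_ ?_
    · rw [← ENNReal.ofReal_tsum_of_nonneg (fun a ↦ by positivity) (hsum.mul_left _)]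
      exact ENNReal.ofReal_ne_top
    · have := hKint.2.ne
      simpa only [hK] using this
  rw [show (∑' a, T a) = ∑' a, ∫ y, F a y from tsum_congr hTF, ← integral_tsum hFmeas hFint]
  -- Step D: evaluate the inner sum
  rw [← integral_const_mul]
  refine integral_congr_ae (Eventually.of_forall fun y ↦ ?_)
  simp only
  set z : ℂ := (c : ℂ) + y * I with hz
  have hsz : 1 < (s + z).re := by simp [hz]; linarith
  have hL := LSeries_mollCoeff (X := X) hsz
  rw [LSeries] at hL
  have hterm : ∀ a : ℕ, F a y = ((1 / (2 * π) : ℝ) : ℂ) * ((Y : ℂ) ^ z * rieszK z) *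
      LSeries.term (mollCoeff X) (s + z) a := by
    intro a
    rcases Nat.eq_zero_or_pos a with rfl | ha
    · simp [hF, LSeries.term_zero, mollCoeff]
    have ha' : (0 : ℝ) < a := by exact_mod_cast ha
    have hane : (a : ℂ) ≠ 0 := by exact_mod_cast ha.ne'
    simp only [hF]
    rw [LSeries.term_of_ne_zero ha.ne', div_natCast_cpow_neg ha' hY z,
      show mollCoeff X a / (a : ℂ) ^ (s + z) = mollCoeff X a * ((a : ℂ) ^ (-s) * (a : ℂ) ^ (-z)) by
        rw [← cpow_add _ _ hane, ← neg_add, cpow_neg, div_eq_mul_inv]]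
    push_cast
    ring
  rw [tsum_congr hterm, tsum_mul_left, hL, hz]
  push_cast
  ring_nf

/-! ### The pieces of the contour shift -/

/-- `K̃(z) = 2/((z+1)(z+2))`, so that `K(z) = K̃(z)/z`. [folklore] -/
def rieszKt (z : ℂ) : ℂ := 2 / ((z + 1) * (z + 2))

/-- `g₁(z) = Y^z M_X(ρ + z)` (entire). [folklore] -/
def shiftAux₁ (X Y : ℕ) (ρ : ℂ) (z : ℂ) : ℂ := (Y : ℂ) ^ z * mollifier X (ρ + z)

/-- `g₀(z) = Y^z ζ₀(ρ + z) M_X(ρ + z)` with `ζ₀(s) = ζ(s) - 1/(s-1)` (entire). [folklore] -/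
def shiftAux₀ (X Y : ℕ) (ρ : ℂ) (z : ℂ) : ℂ := (Y : ℂ) ^ z * riemannZeta₀ (ρ + z) * mollifier X (ρ + z)

/-- `φ = dslope g₁ 0 - (g₁(1-ρ) - g₁(0))/(1-ρ)`, which vanishes at `z₁ = 1 - ρ`. [folklore] -/
def shiftAuxφ (X Y : ℕ) (ρ : ℂ) (z : ℂ) : ℂ :=
  dslope (shiftAux₁ X Y ρ) 0 z - (shiftAux₁ X Y ρ (1 - ρ) - shiftAux₁ X Y ρ 0) / (1 - ρ)

/-- The pole-free part `H₀ = K̃ · dslope g₀ 0`. [folklore] -/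
def shiftPiece₀ (X Y : ℕ) (ρ : ℂ) (z : ℂ) : ℂ := rieszKt z * dslope (shiftAux₀ X Y ρ) 0 z

/-- The pole-free part `H₁ = K̃ · dslope φ (1-ρ)`. [folklore] -/
def shiftPiece₁ (X Y : ℕ) (ρ : ℂ) (z : ℂ) : ℂ := rieszKt z * dslope (shiftAuxφ X Y ρ) (1 - ρ) z

/-- The Perron integrand `perronIntegrand(z) = Y^z K(z) ζ(ρ+z) M_X(ρ+z)`. [folklore] -/
def perronIntegrand (X Y : ℕ) (ρ : ℂ) (z : ℂ) : ℂ :=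
  (Y : ℂ) ^ z * rieszK z * (riemannZeta (ρ + z) * mollifier X (ρ + z))

/-- `‖dslope f a z‖ ≤ (‖f z‖ + ‖f a‖)/‖z - a‖` for `z ≠ a`. [folklore] -/
theorem norm_dslope_le (f : ℂ → ℂ) {a z : ℂ} (h : z ≠ a) :
    ‖dslope f a z‖ ≤ (‖f z‖ + ‖f a‖) / ‖z - a‖ := by
  rw [dslope_of_ne f h, slope_def_module, norm_smul, norm_inv, ← div_eq_inv_mul]
  gcongr
  exact norm_sub_le _ _

/-- `‖K̃(z)‖ ≤ 2/(Im z)²`. [folklore] -/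
theorem norm_rieszKt_le {z : ℂ} (hz : z.im ≠ 0) : ‖rieszKt z‖ ≤ 2 / z.im ^ 2 := by
  have h1 : |z.im| ≤ ‖z + 1‖ := by simpa using Complex.abs_im_le_norm (z + 1)
  have h2 : |z.im| ≤ ‖z + 2‖ := by simpa using Complex.abs_im_le_norm (z + 2)
  have h0 : 0 < |z.im| := abs_pos.2 hz
  rw [rieszKt, norm_div, norm_mul, Complex.norm_two]
  calc 2 / (‖z + 1‖ * ‖z + 2‖) ≤ 2 / (|z.im| * |z.im|) :=
        div_le_div_of_nonneg_left (by norm_num) (by positivity) (mul_le_mul h1 h2 h0.le (norm_nonneg _))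
    _ = 2 / z.im ^ 2 := by rw [← sq_abs, sq]

/-- `K̃` is holomorphic on `Re z > -1`. [folklore] -/
theorem differentiableAt_rieszKt {z : ℂ} (hz : -1 < z.re) : DifferentiableAt ℂ rieszKt z := by
  have h1 : z + 1 ≠ 0 := fun h ↦ by have := congrArg Complex.re h; simp at this; linarith
  have h2 : z + 2 ≠ 0 := fun h ↦ by have := congrArg Complex.re h; simp at this; linarith
  unfold rieszKt
  exact DifferentiableAt.div (differentiableAt_const _) (by fun_prop) (mul_ne_zero h1 h2)

/-- The mollifier `s ↦ M_X(s)` is entire. [folklore] -/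
theorem differentiable_mollifier (X : ℕ) : Differentiable ℂ (mollifier X) := by
  unfold mollifier
  refine Differentiable.fun_sum fun d hd ↦ ?_
  have hd0 : (d : ℂ) ≠ 0 := by
    simp only [Finset.mem_Icc] at hd; exact_mod_cast (by omega : d ≠ 0)
  exact (differentiable_id.neg.const_cpow (Or.inl hd0)).const_mul _

/-- `g₁` is entire (`Y ≥ 1`). [folklore] -/
theorem differentiable_shiftAux₁ (X : ℕ) {Y : ℕ} (hY : 0 < Y) (ρ : ℂ) : Differentiable ℂ (shiftAux₁ X Y ρ) := by
  unfold shiftAux₁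
  have hY0 : (Y : ℂ) ≠ 0 := by exact_mod_cast hY.ne'
  exact (differentiable_id.const_cpow (Or.inl hY0)).mul
    ((differentiable_mollifier X).comp (differentiable_id.const_add ρ))

/-- `g₀` is entire (`Y ≥ 1`). [folklore] -/
theorem differentiable_shiftAux₀ (X : ℕ) {Y : ℕ} (hY : 0 < Y) (ρ : ℂ) : Differentiable ℂ (shiftAux₀ X Y ρ) := by
  unfold shiftAux₀
  have hY0 : (Y : ℂ) ≠ 0 := by exact_mod_cast hY.ne'
  exact ((differentiable_id.const_cpow (Or.inl hY0)).mul
    (differentiable_riemannZeta₀.comp (differentiable_id.const_add ρ))).mul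
    ((differentiable_mollifier X).comp (differentiable_id.const_add ρ))

/-- The half-plane `Re z > -1`, an open neighbourhood of the closed strips used below. [folklore] -/
theorem isOpen_reGt : IsOpen {z : ℂ | -1 < z.re} := isOpen_lt continuous_const Complex.continuous_re

/-- `H₀` is holomorphic on `Re z > -1` (`dslope` of an entire function is entire). [folklore] -/
theorem differentiableOn_shiftPiece₀ (X : ℕ) {Y : ℕ} (hY : 0 < Y) (ρ : ℂ) :
    DifferentiableOn ℂ (shiftPiece₀ X Y ρ) {z : ℂ | -1 < z.re} := by
  have hU : {z : ℂ | -1 < z.re} ∈ 𝓝 (0 : ℂ) := isOpen_reGt.mem_nhds (by simp)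
  have hd : DifferentiableOn ℂ (dslope (shiftAux₀ X Y ρ) 0) {z : ℂ | -1 < z.re} :=
    (differentiableOn_dslope hU).2 (differentiable_shiftAux₀ X hY ρ).differentiableOn
  intro z hz
  exact ((differentiableAt_rieszKt hz).differentiableWithinAt).mul (hd z hz)

/-- `H₁` is holomorphic on `Re z > -1`. [folklore] -/
theorem differentiableOn_shiftPiece₁ (X : ℕ) {Y : ℕ} (hY : 0 < Y) {ρ : ℂ} (hρ : ρ.re < 2) :
    DifferentiableOn ℂ (shiftPiece₁ X Y ρ) {z : ℂ | -1 < z.re} := by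
  have hU0 : {z : ℂ | -1 < z.re} ∈ 𝓝 (0 : ℂ) := isOpen_reGt.mem_nhds (by simp)
  have hU1 : {z : ℂ | -1 < z.re} ∈ 𝓝 (1 - ρ : ℂ) := isOpen_reGt.mem_nhds (by simp; linarith)
  have hd1 : DifferentiableOn ℂ (dslope (shiftAux₁ X Y ρ) 0) {z : ℂ | -1 < z.re} :=
    (differentiableOn_dslope hU0).2 (differentiable_shiftAux₁ X hY ρ).differentiableOn
  have hphi : DifferentiableOn ℂ (shiftAuxφ X Y ρ) {z : ℂ | -1 < z.re} :=
    hd1.sub (differentiableOn_const _)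
  have hd : DifferentiableOn ℂ (dslope (shiftAuxφ X Y ρ) (1 - ρ)) {z : ℂ | -1 < z.re} :=
    (differentiableOn_dslope hU1).2 hphi
  intro z hz
  exact ((differentiableAt_rieszKt hz).differentiableWithinAt).mul (hd z hz)

/-- `ζ(s) ≪ |s|` and hence `ζ₀(s) = ζ(s) - 1/(s-1) ≤ 3|s| + 1` on `Re s ≥ 1/2`, `|Im s| ≥ 1`
(Titchmarsh (2.12.2)). [cite: Titchmarsh1986, §2.12 eq. (2.12.2)] -/
theorem norm_riemannZeta₀_le {s : ℂ} (hs : 1 / 2 ≤ s.re) (hs' : 1 ≤ |s.im|) :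
    ‖riemannZeta₀ s‖ ≤ 3 * ‖s‖ + 1 := by
  have hs1 : s ≠ 1 := by
    intro h; rw [h] at hs'; simp at hs'; linarith
  have him : 1 ≤ ‖s - 1‖ := by
    have := Complex.abs_im_le_norm (s - 1)
    simp at this
    linarith
  have hζ := Literature.NumberTheory.LFunctions.norm_riemannZeta_le_of_re_pos (by linarith) hs1
  have h1 : ‖s‖ / ‖s - 1‖ ≤ ‖s‖ := div_le_self (norm_nonneg _) him
  have h2 : ‖s‖ / s.re ≤ 2 * ‖s‖ := by
    rw [div_le_iff₀ (by linarith)]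
    nlinarith [norm_nonneg s]
  have h3 : ‖(s - 1)⁻¹‖ ≤ 1 := by
    rw [norm_inv]; exact inv_le_one_of_one_le₀ him
  rw [riemannZeta₀, if_neg hs1]
  calc ‖riemannZeta s - (s - 1)⁻¹‖ ≤ ‖riemannZeta s‖ + ‖(s - 1)⁻¹‖ := norm_sub_le _ _
    _ ≤ 3 * ‖s‖ + 1 := by linarith

/-- `‖Y^z‖ = Y^{Re z} ≤ Y^c` for `Re z ≤ c`, `Y ≥ 1`. [folklore] -/
theorem norm_natCast_cpow_le {Y : ℕ} (hY : 1 ≤ Y) {z : ℂ} {c : ℝ} (hz : z.re ≤ c) :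
    ‖(Y : ℂ) ^ z‖ ≤ (Y : ℝ) ^ c := by
  rw [Complex.norm_natCast_cpow_of_pos (by omega)]
  exact Real.rpow_le_rpow_of_exponent_le (by exact_mod_cast hY) hz

/-! ### Bounds on the closed strip `1/2 - Re ρ ≤ Re z ≤ 2` -/

/-- From a bound `‖F(σ+iT)‖ ≤ C/T²` (`|T| ≥ R ≥ 1`) on a strip: the uniform decay hypothesis of the
line-shifting lemma, and integrability on each vertical line of the strip for continuous sections.
[folklore] -/
theorem decay_and_integrable_of_sq_bound {F : ℂ → ℂ} {a b C R : ℝ} (hC : 0 ≤ C) (hR : 1 ≤ R)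
    (h : ∀ σ ∈ Set.Icc a b, ∀ T : ℝ, R ≤ |T| → ‖F (σ + T * I)‖ ≤ C / T ^ 2) :
    (∀ ε : ℝ, 0 < ε → ∃ T₀ : ℝ, ∀ σ ∈ Set.Icc a b, ∀ T : ℝ, T₀ ≤ |T| → ‖F (σ + T * I)‖ ≤ ε) ∧
    (∀ σ ∈ Set.Icc a b, Continuous (fun y : ℝ ↦ F (σ + y * I)) →
      Integrable fun y : ℝ ↦ F (σ + y * I)) := by
  constructor
  · refine Literature.Analysis.Complex.VLI.decay_of_norm_le_div (C := C) (R := R) fun σ hσ T hT ↦ (h σ hσ T hT).trans ?_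
    have hT1 : 1 ≤ |T| := hR.trans hT
    have hT0 : 0 < |T| := by linarith
    rw [← sq_abs]
    exact div_le_div_of_nonneg_left hC hT0 (by nlinarith)
  · intro σ hσ hcont
    refine Literature.Analysis.Complex.VLI.integrable_of_continuous_of_norm_le hcont (C := 2 * C) (R := R) fun y hy ↦ ?_
    have hy1 : 1 ≤ |y| := hR.trans hy
    have hysq : 1 ≤ y ^ 2 := by rw [← sq_abs]; nlinarith
    refine (h σ hσ y hy).trans ?_
    have key : (y ^ 2)⁻¹ ≤ 2 * (1 + y ^ 2)⁻¹ := by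
      rw [← one_div, ← div_eq_mul_inv, div_le_div_iff₀ (by positivity) (by positivity)]
      nlinarith
    calc C / y ^ 2 = C * (y ^ 2)⁻¹ := div_eq_mul_inv _ _
      _ ≤ C * (2 * (1 + y ^ 2)⁻¹) := mul_le_mul_of_nonneg_left key hC
      _ = 2 * C * (1 + y ^ 2)⁻¹ := by ring

section Strip

variable {X Y : ℕ} {ρ : ℂ}

/-- Bound for `H₀` on the strip: `‖H₀(σ+iT)‖ ≤ C/T²` for `|T| ≥ |Im ρ| + 2`. [folklore] -/
theorem norm_shiftPiece₀_le (hX : 1 ≤ X) (hY : 1 ≤ Y) (hβ : 1 / 2 < ρ.re) (hβ1 : ρ.re < 1) :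
    ∃ C : ℝ, 0 ≤ C ∧ ∀ σ ∈ Set.Icc (1 / 2 - ρ.re) 2, ∀ T : ℝ, |ρ.im| + 2 ≤ |T| →
      ‖shiftPiece₀ X Y ρ (σ + T * I)‖ ≤ C / T ^ 2 := by
  set C₀ : ℝ := (Y : ℝ) ^ (2 : ℝ) * X * (3 * ‖ρ‖ + 10) + ‖shiftAux₀ X Y ρ 0‖ with hC₀
  have hC₀0 : 0 ≤ C₀ := by positivity
  refine ⟨2 * C₀, by positivity, fun σ hσ T hT ↦ ?_⟩
  set z : ℂ := σ + T * I with hz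
  have hT1 : 1 ≤ |T| := by linarith [abs_nonneg ρ.im]
  have hT0 : 0 < |T| := by linarith
  have hzim : z.im = T := by simp [hz]
  have hzre : z.re = σ := by simp [hz]
  have hz0 : z ≠ 0 := fun h ↦ by
    have := congrArg Complex.im h; rw [hzim] at this; simp at this; rw [this] at hT0; simp at hT0
  have hnormz : |T| ≤ ‖z‖ := by simpa [hzim] using Complex.abs_im_le_norm z
  -- the factors
  have hKt : ‖rieszKt z‖ ≤ 2 / T ^ 2 := by simpa [hzim] using norm_rieszKt_le (z := z) (by rw [hzim]; exact fun h ↦ by rw [h] at hT0; simp at hT0)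
  have hYz : ‖(Y : ℂ) ^ z‖ ≤ (Y : ℝ) ^ (2 : ℝ) := norm_natCast_cpow_le hY (by rw [hzre]; exact hσ.2)
  have hM : ‖mollifier X (ρ + z)‖ ≤ X := norm_mollifier_le (by simp [hzre]; linarith [hσ.1])
  have hs_re : 1 / 2 ≤ (ρ + z).re := by simp [hzre]; linarith [hσ.1]
  have hs_im : 1 ≤ |(ρ + z).im| := by
    simp only [add_im, hzim]
    have := abs_add_le (-ρ.im) (ρ.im + T)
    simp at this ⊢
    have h2 : |T| ≤ |ρ.im| + |ρ.im + T| := by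
      calc |T| = |-ρ.im + (ρ.im + T)| := by ring_nf
        _ ≤ |-ρ.im| + |ρ.im + T| := abs_add_le _ _
        _ = |ρ.im| + |ρ.im + T| := by rw [abs_neg]
    linarith
  have hζ0 : ‖riemannZeta₀ (ρ + z)‖ ≤ 3 * ‖ρ + z‖ + 1 := norm_riemannZeta₀_le hs_re hs_im
  have hρz : ‖ρ + z‖ ≤ ‖ρ‖ + 2 + |T| := by
    calc ‖ρ + z‖ ≤ ‖ρ‖ + ‖z‖ := norm_add_le _ _
      _ ≤ ‖ρ‖ + (|z.re| + |z.im|) := by linarith [Complex.norm_le_abs_re_add_abs_im z]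
      _ ≤ ‖ρ‖ + 2 + |T| := by
          rw [hzre, hzim]
          have : |σ| ≤ 2 := abs_le.2 ⟨by linarith [hσ.1], hσ.2⟩
          linarith
  have hg0z : ‖shiftAux₀ X Y ρ z‖ ≤ (Y : ℝ) ^ (2 : ℝ) * X * (3 * ‖ρ‖ + 10) * |T| := by
    have e : ‖shiftAux₀ X Y ρ z‖ = ‖(Y : ℂ) ^ z‖ * ‖riemannZeta₀ (ρ + z)‖ * ‖mollifier X (ρ + z)‖ := by
      simp [shiftAux₀]
    rw [e]
    have h1 : ‖riemannZeta₀ (ρ + z)‖ ≤ (3 * ‖ρ‖ + 10) * |T| := by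
      calc ‖riemannZeta₀ (ρ + z)‖ ≤ 3 * (‖ρ‖ + 2 + |T|) + 1 := by linarith
        _ ≤ (3 * ‖ρ‖ + 10) * |T| := by nlinarith [norm_nonneg ρ]
    calc ‖(Y : ℂ) ^ z‖ * ‖riemannZeta₀ (ρ + z)‖ * ‖mollifier X (ρ + z)‖
        ≤ (Y : ℝ) ^ (2 : ℝ) * ((3 * ‖ρ‖ + 10) * |T|) * X := by
          gcongr
      _ = (Y : ℝ) ^ (2 : ℝ) * X * (3 * ‖ρ‖ + 10) * |T| := by ring
  have hds : ‖dslope (shiftAux₀ X Y ρ) 0 z‖ ≤ C₀ := by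
    refine (norm_dslope_le _ hz0).trans ?_
    rw [sub_zero, div_le_iff₀ (by linarith)]
    calc ‖shiftAux₀ X Y ρ z‖ + ‖shiftAux₀ X Y ρ 0‖
        ≤ (Y : ℝ) ^ (2 : ℝ) * X * (3 * ‖ρ‖ + 10) * |T| + ‖shiftAux₀ X Y ρ 0‖ * |T| := by
          have : ‖shiftAux₀ X Y ρ 0‖ ≤ ‖shiftAux₀ X Y ρ 0‖ * |T| := le_mul_of_one_le_right (norm_nonneg _) hT1
          linarith
      _ = C₀ * |T| := by rw [hC₀]; ring
      _ ≤ C₀ * ‖z‖ := mul_le_mul_of_nonneg_left hnormz hC₀0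
  calc ‖shiftPiece₀ X Y ρ z‖ = ‖rieszKt z‖ * ‖dslope (shiftAux₀ X Y ρ) 0 z‖ := by rw [shiftPiece₀, norm_mul]
    _ ≤ 2 / T ^ 2 * C₀ := mul_le_mul hKt hds (norm_nonneg _) (by positivity)
    _ = 2 * C₀ / T ^ 2 := by ring

/-- `φ(1 - ρ) = 0`. [folklore] -/
theorem shiftAuxφ_apply_one_sub (hρ1 : ρ ≠ 1) : shiftAuxφ X Y ρ (1 - ρ) = 0 := by
  have h : (1 - ρ : ℂ) ≠ 0 := sub_ne_zero.2 (Ne.symm hρ1)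
  rw [shiftAuxφ, dslope_of_ne _ h, slope_def_module, sub_zero, smul_eq_mul, ← div_eq_inv_mul, sub_self]

/-- Bound for `H₁` on the strip: `‖H₁(σ+iT)‖ ≤ C/T²` for `|T| ≥ 2|Im ρ| + 2`. [folklore] -/
theorem norm_shiftPiece₁_le (hX : 1 ≤ X) (hY : 1 ≤ Y) (hβ : 1 / 2 < ρ.re) (hβ1 : ρ.re < 1) :
    ∃ C : ℝ, 0 ≤ C ∧ ∀ σ ∈ Set.Icc (1 / 2 - ρ.re) 2, ∀ T : ℝ, 2 * |ρ.im| + 2 ≤ |T| →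
      ‖shiftPiece₁ X Y ρ (σ + T * I)‖ ≤ C / T ^ 2 := by
  have hρ1 : ρ ≠ 1 := fun h ↦ by rw [h] at hβ1; simp at hβ1
  set B : ℝ := (Y : ℝ) ^ (2 : ℝ) * X with hB
  set m : ℂ := (shiftAux₁ X Y ρ (1 - ρ) - shiftAux₁ X Y ρ 0) / (1 - ρ) with hm
  set C₁ : ℝ := B + ‖shiftAux₁ X Y ρ 0‖ + ‖m‖ with hC₁
  have hC₁0 : 0 ≤ C₁ := by positivity
  refine ⟨4 * C₁, by positivity, fun σ hσ T hT ↦ ?_⟩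
  set z : ℂ := σ + T * I with hz
  have hT1 : 1 ≤ |T| := by linarith [abs_nonneg ρ.im]
  have hT0 : 0 < |T| := by linarith
  have hzim : z.im = T := by simp [hz]
  have hzre : z.re = σ := by simp [hz]
  have hz0 : z ≠ 0 := fun h ↦ by
    have := congrArg Complex.im h; rw [hzim] at this; simp at this; rw [this] at hT0; simp at hT0
  have hnormz : |T| ≤ ‖z‖ := by simpa [hzim] using Complex.abs_im_le_norm z
  have hzz1 : |T| / 2 ≤ ‖z - (1 - ρ)‖ := by
    have h1 : |(z - (1 - ρ)).im| ≤ ‖z - (1 - ρ)‖ := Complex.abs_im_le_norm _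
    have h2 : (z - (1 - ρ)).im = T + ρ.im := by simp [hzim]
    rw [h2] at h1
    have h3 : |T| ≤ |T + ρ.im| + |ρ.im| := by
      calc |T| = |(T + ρ.im) + (-ρ.im)| := by ring_nf
        _ ≤ |T + ρ.im| + |-ρ.im| := abs_add_le _ _
        _ = |T + ρ.im| + |ρ.im| := by rw [abs_neg]
    linarith
  have hzne1 : z ≠ 1 - ρ := by
    intro h; rw [h, sub_self, norm_zero] at hzz1; linarith
  -- the factors
  have hKt : ‖rieszKt z‖ ≤ 2 / T ^ 2 := by simpa [hzim] using norm_rieszKt_le (z := z) (by rw [hzim]; exact fun h ↦ by rw [h] at hT0; simp at hT0)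
  have hg1 : ∀ w : ℂ, w.re ≤ 2 → 1 / 2 - ρ.re ≤ w.re → ‖shiftAux₁ X Y ρ w‖ ≤ B := by
    intro w hw1 hw2
    rw [shiftAux₁, norm_mul, hB]
    exact mul_le_mul (norm_natCast_cpow_le hY hw1) (norm_mollifier_le (by simp; linarith))
      (norm_nonneg _) (by positivity)
  have hg1z : ‖shiftAux₁ X Y ρ z‖ ≤ B := hg1 z (by rw [hzre]; exact hσ.2) (by rw [hzre]; exact hσ.1)
  have hds1 : ‖dslope (shiftAux₁ X Y ρ) 0 z‖ ≤ B + ‖shiftAux₁ X Y ρ 0‖ := by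
    refine (norm_dslope_le _ hz0).trans ?_
    rw [sub_zero, div_le_iff₀ (by linarith)]
    calc ‖shiftAux₁ X Y ρ z‖ + ‖shiftAux₁ X Y ρ 0‖ ≤ (B + ‖shiftAux₁ X Y ρ 0‖) * 1 := by linarith
      _ ≤ (B + ‖shiftAux₁ X Y ρ 0‖) * ‖z‖ := mul_le_mul_of_nonneg_left (hT1.trans hnormz) (by positivity)
  have hphi : ‖shiftAuxφ X Y ρ z‖ ≤ C₁ := by
    rw [shiftAuxφ, ← hm]
    calc ‖dslope (shiftAux₁ X Y ρ) 0 z - m‖ ≤ ‖dslope (shiftAux₁ X Y ρ) 0 z‖ + ‖m‖ := norm_sub_le _ _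
      _ ≤ C₁ := by rw [hC₁]; linarith
  have hds : ‖dslope (shiftAuxφ X Y ρ) (1 - ρ) z‖ ≤ 2 * C₁ / |T| := by
    refine (norm_dslope_le _ hzne1).trans ?_
    rw [shiftAuxφ_apply_one_sub hρ1, norm_zero, add_zero]
    calc ‖shiftAuxφ X Y ρ z‖ / ‖z - (1 - ρ)‖ ≤ C₁ / (|T| / 2) :=
          div_le_div₀ hC₁0 hphi (by positivity) hzz1
      _ = 2 * C₁ / |T| := by field_simp
  calc ‖shiftPiece₁ X Y ρ z‖ = ‖rieszKt z‖ * ‖dslope (shiftAuxφ X Y ρ) (1 - ρ) z‖ := by rw [shiftPiece₁, norm_mul]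
    _ ≤ 2 / T ^ 2 * (2 * C₁ / |T|) := mul_le_mul hKt hds (norm_nonneg _) (by positivity)
    _ ≤ 2 / T ^ 2 * (2 * C₁) := by
        apply mul_le_mul_of_nonneg_left _ (by positivity)
        exact div_le_self (by positivity) hT1
    _ = 4 * C₁ / T ^ 2 := by ring

end Strip

/-! ### The pointwise decomposition `perronIntegrand = H₀ + H₁ + A · K̃/(z - z₁)` on the lines -/

section Decomp

variable {X Y : ℕ} {ρ : ℂ}

/-- `ζ₀(ρ) = 1/(1-ρ)` at a zero `ρ` of `ζ`. [folklore] -/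
theorem riemannZeta₀_eq_of_zero (hζ : riemannZeta ρ = 0) (hρ1 : ρ ≠ 1) :
    riemannZeta₀ ρ = (1 - ρ)⁻¹ := by
  have h := riemannZeta_eq_inv_sub_add hρ1
  rw [hζ] at h
  have : riemannZeta₀ ρ = -(ρ - 1)⁻¹ := by linear_combination -h
  rw [this, ← inv_neg, neg_sub]

/-- On a point `z` of a vertical line avoiding `0`, `-1`, `-2` and `z₁ = 1 - ρ`:
`perronIntegrand(z) = H₀(z) + H₁(z) + (g₁(z₁)/z₁) · K̃(z)/(z - z₁)` (partial fractions and `ζ(ρ) = 0`, which kills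
the residue at `z = 0`). [cite: Ivic1985, §11.2 (11.5)–(11.7)] -/
theorem perronIntegrand_eq_decomp (hζ : riemannZeta ρ = 0) (hρ1 : ρ ≠ 1) {z : ℂ} (hz0 : z ≠ 0)
    (hz1 : z + 1 ≠ 0) (hz2 : z + 2 ≠ 0) (hzz : z ≠ 1 - ρ) :
    perronIntegrand X Y ρ z = shiftPiece₀ X Y ρ z + shiftPiece₁ X Y ρ z +
      (shiftAux₁ X Y ρ (1 - ρ) / (1 - ρ)) * (rieszKt z / (z - (1 - ρ))) := by
  have hz1ρ : (1 - ρ : ℂ) ≠ 0 := sub_ne_zero.2 (Ne.symm hρ1)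
  have hρz : ρ + z ≠ 1 := fun h ↦ hzz (by linear_combination h)
  have hρz' : ρ + z - 1 ≠ 0 := sub_ne_zero.2 hρz
  have hzz' : z - (1 - ρ) ≠ 0 := sub_ne_zero.2 hzz
  have hK : rieszK z = rieszKt z / z := by
    rw [rieszK, rieszKt, Literature.NumberTheory.LFunctions.RieszPerron.Kfun_eq hz0 hz1 hz2]
    field_simp
  have hζρz : riemannZeta (ρ + z) = (ρ + z - 1)⁻¹ + riemannZeta₀ (ρ + z) :=
    riemannZeta_eq_inv_sub_add hρz
  have hζ0ρ : riemannZeta₀ ρ = (1 - ρ)⁻¹ := riemannZeta₀_eq_of_zero hζ hρ1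
  -- unfold the `dslope`s
  have hd0 : dslope (shiftAux₀ X Y ρ) 0 z = z⁻¹ * (shiftAux₀ X Y ρ z - shiftAux₀ X Y ρ 0) := by
    rw [dslope_of_ne _ hz0, slope_def_module, sub_zero, smul_eq_mul]
  have hphi : ∀ w : ℂ, w ≠ 0 → shiftAuxφ X Y ρ w =
      w⁻¹ * (shiftAux₁ X Y ρ w - shiftAux₁ X Y ρ 0) - (shiftAux₁ X Y ρ (1 - ρ) - shiftAux₁ X Y ρ 0) / (1 - ρ) := by
    intro w hw
    rw [shiftAuxφ, dslope_of_ne _ hw, slope_def_module, sub_zero, smul_eq_mul]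
  have hd1 : dslope (shiftAuxφ X Y ρ) (1 - ρ) z = (z - (1 - ρ))⁻¹ * (shiftAuxφ X Y ρ z - shiftAuxφ X Y ρ (1 - ρ)) := by
    rw [dslope_of_ne _ hzz, slope_def_module, smul_eq_mul]
  have hg00 : shiftAux₀ X Y ρ 0 = (1 - ρ)⁻¹ * mollifier X ρ := by
    simp [shiftAux₀, hζ0ρ]
  have hg10 : shiftAux₁ X Y ρ 0 = mollifier X ρ := by simp [shiftAux₁]
  rw [perronIntegrand, shiftPiece₀, shiftPiece₁, hd0, hd1, shiftAuxφ_apply_one_sub hρ1, hphi z hz0, hg00, hg10, hK, hζρz]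
  simp only [shiftAux₀, shiftAux₁]
  field_simp
  ring

end Decomp

/-! ### The contour shift and the zero-detecting identity -/

section Shift

variable {X Y : ℕ} {ρ : ℂ}

/-- A point of the vertical line `Re z = c` differs from any `w` with `Re w ≠ c`. [folklore] -/
theorem ofReal_add_mul_I_ne {c : ℝ} {w : ℂ} (h : c ≠ w.re) (y : ℝ) : (c : ℂ) + y * I ≠ w := by
  intro h0
  have := congrArg Complex.re h0
  simp at this
  exact h this

/-- Partial fractions: `K̃(z)/(z - z₁) = A (1/(z+1) - 1/(z-z₁)) + B (1/(z+2) - 1/(z-z₁))` with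
`A = -2/(1+z₁)`, `B = 2/(2+z₁)` (and `A + B = -K̃(z₁)`). [folklore] -/
theorem rieszKt_div_sub_eq {z z₁ : ℂ} (hz1 : z + 1 ≠ 0) (hz2 : z + 2 ≠ 0) (hzz : z - z₁ ≠ 0)
    (h1 : 1 + z₁ ≠ 0) (h2 : 2 + z₁ ≠ 0) :
    rieszKt z / (z - z₁) = (-2 / (1 + z₁)) * (1 / (z + 1) - 1 / (z - z₁)) +
      (2 / (2 + z₁)) * (1 / (z + 2) - 1 / (z - z₁)) := by
  unfold rieszKt
  field_simp
  ring

/-- `A + B = -K̃(z₁)`. [folklore] -/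
theorem neg_two_div_add_two_div {z₁ : ℂ} (h1 : 1 + z₁ ≠ 0) (h2 : 2 + z₁ ≠ 0) :
    (-2 / (1 + z₁)) + (2 / (2 + z₁)) = -rieszKt z₁ := by
  unfold rieszKt
  rw [show z₁ + 1 = 1 + z₁ by ring, show z₁ + 2 = 2 + z₁ by ring]
  field_simp
  ring

/-- The line `Re z = c` (`c > -1`, `c ≠ Re z₁`, `Re z₁ > -1`): integrability of
`y ↦ K̃(z)/(z - z₁)`. [folklore] -/
theorem integrable_rieszKt_div_sub_line {c : ℝ} {z₁ : ℂ} (hc : -1 < c) (hcz : c ≠ z₁.re)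
    (hz₁ : -1 < z₁.re) :
    Integrable fun y : ℝ ↦ rieszKt (c + y * I) / ((c + y * I) - z₁) := by
  have h1 : (1 : ℂ) + z₁ ≠ 0 := fun h ↦ by
    have := congrArg Complex.re h; simp at this; linarith
  have h2 : (2 : ℂ) + z₁ ≠ 0 := fun h ↦ by
    have := congrArg Complex.re h; simp at this; linarith
  have hA := (Literature.Analysis.Complex.VLI.integrable_inv_sub_inv (c := c) (a := -1) (b := z₁) (by simp; linarith)
    (Ne.symm hcz)).const_mul (-2 / (1 + z₁))
  have hB := (Literature.Analysis.Complex.VLI.integrable_inv_sub_inv (c := c) (a := -2) (b := z₁) (by simp; linarith)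
    (Ne.symm hcz)).const_mul (2 / (2 + z₁))
  refine (hA.add hB).congr (Eventually.of_forall fun y ↦ ?_)
  have hz1 : (c : ℂ) + y * I + 1 ≠ 0 := by
    have := ofReal_add_mul_I_ne (c := c) (w := -1) (by simp; linarith) y
    intro h; apply this; linear_combination h
  have hz2 : (c : ℂ) + y * I + 2 ≠ 0 := by
    have := ofReal_add_mul_I_ne (c := c) (w := -2) (by simp; linarith) y
    intro h; apply this; linear_combination h
  have hzz : (c : ℂ) + y * I - z₁ ≠ 0 := sub_ne_zero.2 (ofReal_add_mul_I_ne hcz y)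
  simp only [Pi.add_apply]
  rw [rieszKt_div_sub_eq hz1 hz2 hzz h1 h2, sub_neg_eq_add,
    show (c : ℂ) + y * I - (-2) = (c : ℂ) + y * I + 2 by ring]

/-- The line integral `∫_{Re z = c} K̃(z)/(z - z₁) dy` equals `0` if `Re z₁ < c` and `-2π K̃(z₁)`
if `c < Re z₁` (for `c > -1`, `Re z₁ > -1`): the residue at the simple pole `z₁`. [folklore] -/
theorem integral_rieszKt_div_sub_line {c : ℝ} {z₁ : ℂ} (hc : -1 < c) (hcz : c ≠ z₁.re)
    (hz₁ : -1 < z₁.re) :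
    ∫ y : ℝ, rieszKt (c + y * I) / ((c + y * I) - z₁) =
      if z₁.re < c then 0 else -(2 * π) * rieszKt z₁ := by
  have h1 : (1 : ℂ) + z₁ ≠ 0 := fun h ↦ by
    have := congrArg Complex.re h; simp at this; linarith
  have h2 : (2 : ℂ) + z₁ ≠ 0 := fun h ↦ by
    have := congrArg Complex.re h; simp at this; linarith
  have hIa := Literature.Analysis.Complex.VLI.integrable_inv_sub_inv (c := c) (a := -1) (b := z₁) (by simp; linarith)
    (Ne.symm hcz)
  have hIb := Literature.Analysis.Complex.VLI.integrable_inv_sub_inv (c := c) (a := -2) (b := z₁) (by simp; linarith)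
    (Ne.symm hcz)
  have hVa := Literature.Analysis.Complex.VLI.integral_inv_sub_inv (c := c) (a := -1) (b := z₁) (by simp; linarith)
    (Ne.symm hcz)
  have hVb := Literature.Analysis.Complex.VLI.integral_inv_sub_inv (c := c) (a := -2) (b := z₁) (by simp; linarith)
    (Ne.symm hcz)
  have hpt : ∀ y : ℝ, rieszKt (c + y * I) / ((c + y * I) - z₁) =
      (-2 / (1 + z₁)) * (1 / ((c : ℂ) + y * I - (-1)) - 1 / ((c : ℂ) + y * I - z₁)) +
      (2 / (2 + z₁)) * (1 / ((c : ℂ) + y * I - (-2)) - 1 / ((c : ℂ) + y * I - z₁)) := by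
    intro y
    have hz1 : (c : ℂ) + y * I + 1 ≠ 0 := by
      have := ofReal_add_mul_I_ne (c := c) (w := -1) (by simp; linarith) y
      intro h; apply this; linear_combination h
    have hz2 : (c : ℂ) + y * I + 2 ≠ 0 := by
      have := ofReal_add_mul_I_ne (c := c) (w := -2) (by simp; linarith) y
      intro h; apply this; linear_combination h
    have hzz : (c : ℂ) + y * I - z₁ ≠ 0 := sub_ne_zero.2 (ofReal_add_mul_I_ne hcz y)
    rw [rieszKt_div_sub_eq hz1 hz2 hzz h1 h2, sub_neg_eq_add, sub_neg_eq_add]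
  simp_rw [hpt]
  rw [integral_add (hIa.const_mul _) (hIb.const_mul _), integral_const_mul, integral_const_mul,
    hVa, hVb]
  have ha1 : ((-1 : ℂ)).re < c := by simp; linarith
  have ha2 : ((-2 : ℂ)).re < c := by simp; linarith
  rw [if_pos ha1, if_pos ha2]
  by_cases hlt : z₁.re < c
  · rw [if_pos hlt, if_pos hlt]; ring
  · rw [if_neg hlt, if_neg hlt]
    linear_combination (2 * (π : ℂ)) * neg_two_div_add_two_div h1 h2

/-- Continuity of the sections `y ↦ H(σ + iy)` of a function differentiable on `Re z > -1`,
for `σ > -1`. [folklore] -/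
theorem continuous_line_of_differentiableOn {H : ℂ → ℂ}
    (hH : DifferentiableOn ℂ H {z : ℂ | -1 < z.re}) {σ : ℝ} (hσ : -1 < σ) :
    Continuous fun y : ℝ ↦ H (σ + y * I) :=
  hH.continuousOn.comp_continuous (by fun_prop) fun y ↦ by simp; linarith

/-- The contour shift for the pole-free pieces: for `H = H₀` or `H₁`,
`∫ H(1/2 - β + iy) dy = ∫ H(2 + iy) dy`, and both sections are integrable. [folklore] -/
theorem integral_line_eq_of_sq_bound {H : ℂ → ℂ} (hH : DifferentiableOn ℂ H {z : ℂ | -1 < z.re})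
    {a : ℝ} (ha : -1 < a) (ha2 : a ≤ 2) {C R : ℝ} (hC : 0 ≤ C) (hR : 1 ≤ R)
    (hb : ∀ σ ∈ Set.Icc a 2, ∀ T : ℝ, R ≤ |T| → ‖H (σ + T * I)‖ ≤ C / T ^ 2) :
    Integrable (fun y : ℝ ↦ H (a + y * I)) ∧ Integrable (fun y : ℝ ↦ H ((2 : ℝ) + y * I)) ∧
      ∫ y : ℝ, H (a + y * I) = ∫ y : ℝ, H ((2 : ℝ) + y * I) := by
  obtain ⟨hdecay, hint⟩ := decay_and_integrable_of_sq_bound hC hR hb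
  have hIa : Integrable (fun y : ℝ ↦ H (a + y * I)) :=
    hint a ⟨le_rfl, ha2⟩ (continuous_line_of_differentiableOn hH ha)
  have hIb : Integrable (fun y : ℝ ↦ H ((2 : ℝ) + y * I)) :=
    hint 2 ⟨ha2, le_rfl⟩ (continuous_line_of_differentiableOn hH (by norm_num))
  refine ⟨hIa, hIb, ?_⟩
  refine Literature.NumberTheory.LFunctions.MertensBoundRH.integral_vertical_eq_of_tendsto H ha2 (hH.mono ?_) hIa hIb hdecay
  intro z hz
  rw [Complex.mem_reProdIm] at hz
  show -1 < z.re
  linarith [hz.1.1]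

/-- `ρ + (1/2 - β + iy) = 1/2 + i(γ + y)` for `ρ = β + iγ`. [folklore] -/
theorem rho_add_line (ρ : ℂ) (y : ℝ) :
    ρ + (((1 / 2 - ρ.re : ℝ) : ℂ) + y * I) = 1 / 2 + (ρ.im + y) * I := by
  apply Complex.ext <;> simp

/-- **The zero-detecting identity with integrability** (Ivić (11.7), Riesz-kernel variant): the
line integrand `y ↦ Y^{1/2-β+iy} K(1/2-β+iy) ζ(1/2+i(γ+y)) M_X(1/2+i(γ+y))` is integrable on `ℝ`
and the identity of `zeroDetection_identity` holds. [cite: Ivic1985, §11.2 (11.4)–(11.7)] -/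
theorem zeroDetection_main (hX : 1 ≤ X) (hY : 1 ≤ Y) (hβ : 1 / 2 < ρ.re) (hβ1 : ρ.re < 1)
    (hζ : riemannZeta ρ = 0) :
    Integrable (fun y : ℝ ↦
        (Y : ℂ) ^ (((1 / 2 - ρ.re : ℝ) : ℂ) + y * I) * rieszK (((1 / 2 - ρ.re : ℝ) : ℂ) + y * I) *
          (riemannZeta (1 / 2 + (ρ.im + y) * I) * mollifier X (1 / 2 + (ρ.im + y) * I))) ∧
    ∑ n ∈ Finset.range Y, mollCoeff X (n + 1) *
        ((((1 : ℝ) - ((n : ℝ) + 1) / Y) ^ 2 : ℝ) : ℂ) * ((n : ℂ) + 1) ^ (-ρ) =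
      (Y : ℂ) ^ (1 - ρ) * rieszK (1 - ρ) * mollifier X 1 +
      ((1 / (2 * π) : ℝ) : ℂ) * ∫ y : ℝ,
        (Y : ℂ) ^ (((1 / 2 - ρ.re : ℝ) : ℂ) + y * I) * rieszK (((1 / 2 - ρ.re : ℝ) : ℂ) + y * I) *
          (riemannZeta (1 / 2 + (ρ.im + y) * I) * mollifier X (1 / 2 + (ρ.im + y) * I)) := by
  have hY0 : 0 < Y := hY
  have hρ1 : ρ ≠ 1 := fun h ↦ by rw [h] at hβ1; simp at hβ1
  set a : ℝ := 1 / 2 - ρ.re with ha_def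
  have ha : -1 < a := by rw [ha_def]; linarith
  have ha0 : a < 0 := by rw [ha_def]; linarith
  have ha2 : a ≤ 2 := by linarith
  set z₁ : ℂ := 1 - ρ with hz₁_def
  have hz₁re : z₁.re = 1 - ρ.re := by simp [hz₁_def]
  have hz₁0 : z₁ ≠ 0 := sub_ne_zero.2 (Ne.symm hρ1)
  have hz₁1 : (1 : ℂ) + z₁ ≠ 0 := fun h ↦ by
    have := congrArg Complex.re h; rw [add_re, hz₁re] at this; simp at this; linarith
  have hz₁2 : (2 : ℂ) + z₁ ≠ 0 := fun h ↦ by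
    have := congrArg Complex.re h; rw [add_re, hz₁re] at this; simp at this; linarith
  set A : ℂ := shiftAux₁ X Y ρ z₁ / z₁ with hA_def
  -- Step 1: Perron on `Re z = 2`
  have hPerron := rieszSum_eq_integral (c := 2) (by norm_num) (s := ρ) (by linarith) X hY0
  rw [hPerron]
  -- the integrand on `Re z = 2` is `perronIntegrand(2 + iy)`
  have hG2 : ∀ y : ℝ, (Y : ℂ) ^ (((2 : ℝ) : ℂ) + y * I) * rieszK (((2 : ℝ) : ℂ) + y * I) *
      (riemannZeta (ρ + (2 : ℝ) + y * I) * mollifier X (ρ + (2 : ℝ) + y * I)) =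
      perronIntegrand X Y ρ (((2 : ℝ) : ℂ) + y * I) := by
    intro y; simp only [perronIntegrand, add_assoc]
  simp_rw [hG2]
  -- Step 2: the three pieces on the two lines
  obtain ⟨C₀, hC₀0, hC₀⟩ := norm_shiftPiece₀_le (X := X) (Y := Y) (ρ := ρ) hX hY hβ hβ1
  obtain ⟨C₁, hC₁0, hC₁⟩ := norm_shiftPiece₁_le (X := X) (Y := Y) (ρ := ρ) hX hY hβ hβ1
  have hR0 : 1 ≤ |ρ.im| + 2 := by linarith [abs_nonneg ρ.im]
  have hR1 : 1 ≤ 2 * |ρ.im| + 2 := by linarith [abs_nonneg ρ.im]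
  obtain ⟨hI0a, hI0b, hS0⟩ := integral_line_eq_of_sq_bound (differentiableOn_shiftPiece₀ X hY0 ρ) ha ha2
    hC₀0 hR0 hC₀
  obtain ⟨hI1a, hI1b, hS1⟩ := integral_line_eq_of_sq_bound
    (differentiableOn_shiftPiece₁ X hY0 (ρ := ρ) (by linarith)) ha ha2 hC₁0 hR1 hC₁
  have hz₁a : a ≠ z₁.re := by rw [hz₁re]; linarith
  have hz₁b : (2 : ℝ) ≠ z₁.re := by rw [hz₁re]; linarith
  have hz₁m : -1 < z₁.re := by rw [hz₁re]; linarith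
  have hIKa := integrable_rieszKt_div_sub_line (z₁ := z₁) ha hz₁a hz₁m
  have hIKb := integrable_rieszKt_div_sub_line (z₁ := z₁) (c := 2) (by norm_num) hz₁b hz₁m
  have hVKa := integral_rieszKt_div_sub_line (z₁ := z₁) ha hz₁a hz₁m
  have hVKb := integral_rieszKt_div_sub_line (z₁ := z₁) (c := 2) (by norm_num) hz₁b hz₁m
  rw [if_neg (by rw [hz₁re]; linarith)] at hVKa
  rw [if_pos (by rw [hz₁re]; linarith)] at hVKb
  -- pointwise decompositions on the two lines
  have hdec : ∀ (c : ℝ), c ≠ 0 → -1 < c → c ≠ z₁.re → ∀ y : ℝ,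
      perronIntegrand X Y ρ ((c : ℂ) + y * I) = shiftPiece₀ X Y ρ ((c : ℂ) + y * I) + shiftPiece₁ X Y ρ ((c : ℂ) + y * I) +
        A * (rieszKt ((c : ℂ) + y * I) / (((c : ℂ) + y * I) - z₁)) := by
    intro c hc0 hc1 hcz y
    have h0 : (c : ℂ) + y * I ≠ 0 := ofReal_add_mul_I_ne (w := 0) (by simpa using hc0) y
    have h1 : (c : ℂ) + y * I + 1 ≠ 0 := by
      have := ofReal_add_mul_I_ne (c := c) (w := -1) (by simp; linarith) y
      intro h; apply this; linear_combination h
    have h2 : (c : ℂ) + y * I + 2 ≠ 0 := by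
      have := ofReal_add_mul_I_ne (c := c) (w := -2) (by simp; linarith) y
      intro h; apply this; linear_combination h
    have hzz : (c : ℂ) + y * I ≠ 1 - ρ := ofReal_add_mul_I_ne (by rwa [← hz₁_def]) y
    exact perronIntegrand_eq_decomp hζ hρ1 h0 h1 h2 hzz
  -- Step 3: integral on `Re z = 2`
  have hInt2 : ∫ y : ℝ, perronIntegrand X Y ρ (((2 : ℝ) : ℂ) + y * I) =
      (∫ y : ℝ, shiftPiece₀ X Y ρ (((2 : ℝ) : ℂ) + y * I)) + ∫ y : ℝ, shiftPiece₁ X Y ρ (((2 : ℝ) : ℂ) + y * I) := by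
    have e : (fun y : ℝ ↦ perronIntegrand X Y ρ (((2 : ℝ) : ℂ) + y * I)) = fun y : ℝ ↦
        (shiftPiece₀ X Y ρ (((2 : ℝ) : ℂ) + y * I) + shiftPiece₁ X Y ρ (((2 : ℝ) : ℂ) + y * I)) +
        A * (rieszKt (((2 : ℝ) : ℂ) + y * I) / ((((2 : ℝ) : ℂ) + y * I) - z₁)) := by
      funext y; exact hdec 2 (by norm_num) (by norm_num) hz₁b y
    have hI01b : Integrable fun y : ℝ ↦
        shiftPiece₀ X Y ρ (((2 : ℝ) : ℂ) + y * I) + shiftPiece₁ X Y ρ (((2 : ℝ) : ℂ) + y * I) := hI0b.add hI1b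
    rw [e, integral_add hI01b (hIKb.const_mul A), integral_add hI0b hI1b,
      integral_const_mul]
    have : (∫ y : ℝ, rieszKt (((2 : ℝ) : ℂ) + y * I) / ((((2 : ℝ) : ℂ) + y * I) - z₁)) = 0 := by
      exact_mod_cast hVKb
    rw [this, mul_zero, add_zero]
  -- Step 4: integrability and the integral on `Re z = a`
  have hIG : Integrable fun y : ℝ ↦ perronIntegrand X Y ρ ((a : ℂ) + y * I) := by
    have e' : (fun y : ℝ ↦ perronIntegrand X Y ρ ((a : ℂ) + y * I)) = fun y : ℝ ↦
        (shiftPiece₀ X Y ρ ((a : ℂ) + y * I) + shiftPiece₁ X Y ρ ((a : ℂ) + y * I)) +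
        A * (rieszKt ((a : ℂ) + y * I) / (((a : ℂ) + y * I) - z₁)) := by
      funext y; exact hdec a ha0.ne ha hz₁a y
    rw [e']
    exact (hI0a.add hI1a).add (hIKa.const_mul A)
  have hInta : (∫ y : ℝ, shiftPiece₀ X Y ρ ((a : ℂ) + y * I)) + (∫ y : ℝ, shiftPiece₁ X Y ρ ((a : ℂ) + y * I)) =
      (∫ y : ℝ, perronIntegrand X Y ρ ((a : ℂ) + y * I)) + A * ((2 * π) * rieszKt z₁) := by
    have e : (fun y : ℝ ↦ shiftPiece₀ X Y ρ ((a : ℂ) + y * I) + shiftPiece₁ X Y ρ ((a : ℂ) + y * I)) = fun y : ℝ ↦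
        perronIntegrand X Y ρ ((a : ℂ) + y * I) + (-A) * (rieszKt ((a : ℂ) + y * I) / (((a : ℂ) + y * I) - z₁)) := by
      funext y; rw [hdec a ha0.ne ha hz₁a y]; ring
    rw [← integral_add hI0a hI1a, e, integral_add hIG (hIKa.const_mul _), integral_const_mul, hVKa]
    ring
  -- Step 5: the residue term
  have hres : A * ((2 * π) * rieszKt z₁) =
      (2 * π) * ((Y : ℂ) ^ (1 - ρ) * rieszK (1 - ρ) * mollifier X 1) := by
    have hK : rieszK z₁ = rieszKt z₁ / z₁ := by
      have h1' : z₁ + 1 ≠ 0 := by rw [add_comm]; exact hz₁1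
      have h2' : z₁ + 2 ≠ 0 := by rw [add_comm]; exact hz₁2
      rw [rieszK, rieszKt, Literature.NumberTheory.LFunctions.RieszPerron.Kfun_eq hz₁0 h1' h2']
      field_simp
    rw [hA_def, shiftAux₁, hK, show ρ + z₁ = 1 by rw [hz₁_def]; ring, hz₁_def]
    field_simp
  -- Step 6: assemble
  have hGa : ∀ y : ℝ, perronIntegrand X Y ρ ((a : ℂ) + y * I) =
      (Y : ℂ) ^ (((1 / 2 - ρ.re : ℝ) : ℂ) + y * I) * rieszK (((1 / 2 - ρ.re : ℝ) : ℂ) + y * I) *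
        (riemannZeta (1 / 2 + (ρ.im + y) * I) * mollifier X (1 / 2 + (ρ.im + y) * I)) := by
    intro y
    simp only [perronIntegrand, ha_def, rho_add_line]
  refine ⟨by simp_rw [hGa] at hIG; exact hIG, ?_⟩
  rw [hInt2, ← hS0, ← hS1, hInta, hres]
  simp_rw [hGa]
  generalize (∫ y : ℝ, (Y : ℂ) ^ (((1 / 2 - ρ.re : ℝ) : ℂ) + y * I) *
    rieszK (((1 / 2 - ρ.re : ℝ) : ℂ) + y * I) *
      (riemannZeta (1 / 2 + (ρ.im + y) * I) * mollifier X (1 / 2 + (ρ.im + y) * I))) = J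
  have hπ : (π : ℂ) ≠ 0 := by exact_mod_cast Real.pi_ne_zero
  push_cast
  field_simp
  ring

/-- **Integrability of the zero-detecting line integrand** on `Re w = 1/2 - β`: needed by any
consumer of `zeroDetection_norm_ineq` (Mathlib's integral of a non-integrable function is `0`).
[cite: Ivic1985, §11.2 (11.7)] -/
theorem integrable_zeroDetection_integrand (hX : 1 ≤ X) (hY : 1 ≤ Y) (hβ : 1 / 2 < ρ.re)
    (hβ1 : ρ.re < 1) (hζ : riemannZeta ρ = 0) :
    Integrable (fun y : ℝ ↦
        (Y : ℂ) ^ (((1 / 2 - ρ.re : ℝ) : ℂ) + y * I) * rieszK (((1 / 2 - ρ.re : ℝ) : ℂ) + y * I) *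
          (riemannZeta (1 / 2 + (ρ.im + y) * I) * mollifier X (1 / 2 + (ρ.im + y) * I))) :=
  (zeroDetection_main hX hY hβ hβ1 hζ).1

/-- **The zero-detecting identity** (Ivić (11.7), Riesz-kernel variant). Let `ρ = β + iγ` be a zero
of `ζ` with `1/2 < β < 1`, and `X, Y ≥ 1` integers. Then
`∑_{n ≤ Y} a_X(n) (1 - n/Y)² n^{-ρ} = Y^{1-ρ} K(1-ρ) M_X(1)`
`+ (1/2π) ∫_ℝ Y^{1/2-β+iy} K(1/2-β+iy) ζ(1/2 + i(γ+y)) M_X(1/2 + i(γ+y)) dy`: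
Perron's formula on `Re w = 2` moved to `Re w = 1/2 - β`, the pole of `K` at `w = 0` being
cancelled by `ζ(ρ) = 0` and the pole of `ζ(ρ + w)` at `w = 1 - ρ` contributing the first term.
[cite: Ivic1985, §11.2 (11.4)–(11.7)] -/
theorem zeroDetection_identity (hX : 1 ≤ X) (hY : 1 ≤ Y) (hβ : 1 / 2 < ρ.re) (hβ1 : ρ.re < 1)
    (hζ : riemannZeta ρ = 0) :
    ∑ n ∈ Finset.range Y, mollCoeff X (n + 1) *
        ((((1 : ℝ) - ((n : ℝ) + 1) / Y) ^ 2 : ℝ) : ℂ) * ((n : ℂ) + 1) ^ (-ρ) =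
      (Y : ℂ) ^ (1 - ρ) * rieszK (1 - ρ) * mollifier X 1 +
      ((1 / (2 * π) : ℝ) : ℂ) * ∫ y : ℝ,
        (Y : ℂ) ^ (((1 / 2 - ρ.re : ℝ) : ℂ) + y * I) * rieszK (((1 / 2 - ρ.re : ℝ) : ℂ) + y * I) *
          (riemannZeta (1 / 2 + (ρ.im + y) * I) * mollifier X (1 / 2 + (ρ.im + y) * I)) :=
  (zeroDetection_main hX hY hβ hβ1 hζ).2

/-- The Riesz sum written over `1 ≤ n ≤ Y`. [folklore] -/
theorem rieszSum_eq_sum_Icc (X Y : ℕ) (s : ℂ) :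
    ∑ n ∈ Finset.range Y, mollCoeff X (n + 1) *
        ((((1 : ℝ) - ((n : ℝ) + 1) / Y) ^ 2 : ℝ) : ℂ) * ((n : ℂ) + 1) ^ (-s) =
      ∑ n ∈ Finset.Icc 1 Y, mollCoeff X n *
        ((((1 : ℝ) - (n : ℝ) / Y) ^ 2 : ℝ) : ℂ) * (n : ℂ) ^ (-s) := by
  rw [Finset.range_eq_Ico, ← Finset.Ico_add_one_right_eq_Icc, ← Finset.sum_Ico_add' _ 0 Y 1]
  refine Finset.sum_congr rfl fun n _ ↦ ?_
  push_cast
  ring_nf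

/-- With `a_X(n) = 0` for `1 < n ≤ X` (`X ≥ 1`): the Riesz sum is its `n = 1` term `(1 - 1/Y)²` plus
the tail over `X < n ≤ Y`. [cite: Ivic1985, (11.8)] -/
theorem sum_Icc_eq_first_add_sum_Ioc (hX : 1 ≤ X) (hY : 1 ≤ Y) (s : ℂ) :
    ∑ n ∈ Finset.Icc 1 Y, mollCoeff X n * ((((1 : ℝ) - (n : ℝ) / Y) ^ 2 : ℝ) : ℂ) * (n : ℂ) ^ (-s) =
      ((((1 : ℝ) - 1 / Y) ^ 2 : ℝ) : ℂ) +
      ∑ n ∈ Finset.Ioc X Y, mollCoeff X n * ((((1 : ℝ) - (n : ℝ) / Y) ^ 2 : ℝ) : ℂ) * (n : ℂ) ^ (-s) := by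
  rw [← Finset.add_sum_Ioc_eq_sum_Icc hY, mollCoeff_one hX]
  congr 1
  · simp
  · symm
    refine Finset.sum_subset (fun n hn ↦ ?_) (fun n hn hn' ↦ ?_)
    · simp only [Finset.mem_Ioc] at hn ⊢
      exact ⟨by omega, hn.2⟩
    · simp only [Finset.mem_Ioc, not_and, not_le] at hn hn'
      have hnX : n ≤ X := by
        by_contra h
        exact absurd (hn' (by omega)) (by omega)
      rw [mollCoeff_eq_zero hn.1 hnX]
      simp

/-- **The zero-detecting inequality** (Class I / Class II dichotomy, Ivić (11.8)–(11.10) with the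
Riesz kernel). For a zero `ρ = β + iγ` of `ζ` with `1/2 < β < 1` and integers `X, Y ≥ 1`:
`(1 - 1/Y)² ≤ |∑_{X<n≤Y} a_X(n)(1-n/Y)² n^{-ρ}| + Y^{1-β} |K(1-ρ)| (1 + log X)`
`+ (Y^{1/2-β}/2π) ∫_ℝ |K(1/2-β+iy)| |ζ(1/2+i(γ+y))| |M_X(1/2+i(γ+y))| dy`.
[cite: Ivic1985, §11.2 (11.8)–(11.10)] -/
theorem zeroDetection_norm_ineq (hX : 1 ≤ X) (hY : 1 ≤ Y) (hβ : 1 / 2 < ρ.re) (hβ1 : ρ.re < 1)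
    (hζ : riemannZeta ρ = 0) :
    ((1 : ℝ) - 1 / Y) ^ 2 ≤
      ‖∑ n ∈ Finset.Ioc X Y, mollCoeff X n *
          ((((1 : ℝ) - (n : ℝ) / Y) ^ 2 : ℝ) : ℂ) * (n : ℂ) ^ (-ρ)‖ +
      (Y : ℝ) ^ (1 - ρ.re) * ‖rieszK (1 - ρ)‖ * (1 + Real.log X) +
      1 / (2 * π) * (Y : ℝ) ^ (1 / 2 - ρ.re) *
        ∫ y : ℝ, ‖rieszK (((1 / 2 - ρ.re : ℝ) : ℂ) + y * I)‖ *
          (‖riemannZeta (1 / 2 + (ρ.im + y) * I)‖ * ‖mollifier X (1 / 2 + (ρ.im + y) * I)‖) := by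
  have hY0 : (0 : ℝ) < Y := by exact_mod_cast hY
  have hid := zeroDetection_identity hX hY hβ hβ1 hζ
  rw [rieszSum_eq_sum_Icc, sum_Icc_eq_first_add_sum_Ioc hX hY] at hid
  set S := ∑ n ∈ Finset.Ioc X Y, mollCoeff X n *
    ((((1 : ℝ) - (n : ℝ) / Y) ^ 2 : ℝ) : ℂ) * (n : ℂ) ^ (-ρ) with hS
  set R := (Y : ℂ) ^ (1 - ρ) * rieszK (1 - ρ) * mollifier X 1 with hR
  set F : ℝ → ℂ := fun y ↦ (Y : ℂ) ^ (((1 / 2 - ρ.re : ℝ) : ℂ) + y * I) *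
    rieszK (((1 / 2 - ρ.re : ℝ) : ℂ) + y * I) *
      (riemannZeta (1 / 2 + (ρ.im + y) * I) * mollifier X (1 / 2 + (ρ.im + y) * I)) with hF
  have hJ : (∫ y : ℝ, (Y : ℂ) ^ (((1 / 2 - ρ.re : ℝ) : ℂ) + y * I) *
    rieszK (((1 / 2 - ρ.re : ℝ) : ℂ) + y * I) *
      (riemannZeta (1 / 2 + (ρ.im + y) * I) * mollifier X (1 / 2 + (ρ.im + y) * I))) = ∫ y, F y := rfl
  rw [hJ] at hid
  -- `(1 - 1/Y)² = -S + R + (1/2π) ∫ F`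
  have heq : ((((1 : ℝ) - 1 / Y) ^ 2 : ℝ) : ℂ) = -S + R + ((1 / (2 * π) : ℝ) : ℂ) * ∫ y, F y := by
    linear_combination hid
  -- norms of the three pieces
  have hnS : ‖-S‖ = ‖S‖ := norm_neg _
  have hnR : ‖R‖ ≤ (Y : ℝ) ^ (1 - ρ.re) * ‖rieszK (1 - ρ)‖ * (1 + Real.log X) := by
    rw [hR, norm_mul, norm_mul, Complex.norm_natCast_cpow_of_pos hY, sub_re, one_re]
    exact mul_le_mul_of_nonneg_left (norm_mollifier_one_le X) (by positivity)
  have hnF : ∀ y : ℝ, ‖F y‖ = (Y : ℝ) ^ (1 / 2 - ρ.re) *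
      (‖rieszK (((1 / 2 - ρ.re : ℝ) : ℂ) + y * I)‖ *
        (‖riemannZeta (1 / 2 + (ρ.im + y) * I)‖ * ‖mollifier X (1 / 2 + (ρ.im + y) * I)‖)) := by
    intro y
    simp only [hF, norm_mul, Complex.norm_natCast_cpow_of_pos hY, add_re, ofReal_re, mul_re,
      I_re, I_im, ofReal_im]
    ring_nf
  have hnI : ‖((1 / (2 * π) : ℝ) : ℂ) * ∫ y, F y‖ ≤ 1 / (2 * π) * (Y : ℝ) ^ (1 / 2 - ρ.re) *
      ∫ y : ℝ, ‖rieszK (((1 / 2 - ρ.re : ℝ) : ℂ) + y * I)‖ *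
        (‖riemannZeta (1 / 2 + (ρ.im + y) * I)‖ * ‖mollifier X (1 / 2 + (ρ.im + y) * I)‖) := by
    rw [norm_mul, Complex.norm_real, Real.norm_of_nonneg (by positivity), mul_assoc]
    refine mul_le_mul_of_nonneg_left ?_ (by positivity)
    calc ‖∫ y, F y‖ ≤ ∫ y, ‖F y‖ := norm_integral_le_integral_norm _
      _ = ∫ y : ℝ, (Y : ℝ) ^ (1 / 2 - ρ.re) *
          (‖rieszK (((1 / 2 - ρ.re : ℝ) : ℂ) + y * I)‖ *
            (‖riemannZeta (1 / 2 + (ρ.im + y) * I)‖ * ‖mollifier X (1 / 2 + (ρ.im + y) * I)‖)) :=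
          integral_congr_ae (Eventually.of_forall hnF)
      _ = (Y : ℝ) ^ (1 / 2 - ρ.re) * ∫ y : ℝ, ‖rieszK (((1 / 2 - ρ.re : ℝ) : ℂ) + y * I)‖ *
            (‖riemannZeta (1 / 2 + (ρ.im + y) * I)‖ * ‖mollifier X (1 / 2 + (ρ.im + y) * I)‖) :=
          integral_const_mul _ _
  have hlhs : ((1 : ℝ) - 1 / Y) ^ 2 = ‖((((1 : ℝ) - 1 / Y) ^ 2 : ℝ) : ℂ)‖ := by
    rw [Complex.norm_real, Real.norm_of_nonneg (sq_nonneg _)]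
  rw [hlhs, heq]
  calc ‖-S + R + ((1 / (2 * π) : ℝ) : ℂ) * ∫ y, F y‖
      ≤ ‖-S‖ + ‖R‖ + ‖((1 / (2 * π) : ℝ) : ℂ) * ∫ y, F y‖ := norm_add₃_le
    _ ≤ _ := by rw [hnS]; linarith

end Shift

end ZeroDetect

end Literature.NumberTheory.LFunctions
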